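import Mathlib
import HarnessLib
import Summits.Ventures.LatticeQCDFlow.Exactness.SUNLeapfrogEnergyError
import Summits.Ventures.LatticeQCDFlow.Exactness.SUNOmf2TrajectoryEnergyError
import Summits.Ventures.LatticeQCDFlow.Exactness.SUNEnginePairing

/-!
# THE ENGINE'S OWN `SU(N)` KERNEL (coordinates `sunCoordι N`, kinetic term `sunKinetic N = −Σ tr P²`): the energy error of its `n`-step leapfrog proposal and of its `n`-step OMF2 proposal with the consistent kicks is `O(nε²)`, with every constant explicit in `N`

HONEST FRAMING: exact (Metropolis-corrected) sampling algorithms for lattice gauge theory;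
figures of merit are autocorrelation/cost numbers at stated couplings and volumes; no
continuum-physics claim.

Venture `LatticeQCDFlow` (cell pub-lqcd), topic `Exactness`; FANOUT row 14 (`eng-flowhmc`, family B; the `SU(N)` rung of
rows 21–26 — `SU(3)` — runs row 9's engine coordinates).  NEW WORK of the cell: the general-coordinates laws
`SUNLeapfrogEnergyError` (`abs_sunLeapfrogProposalN_energy_error_le`) and `SUNOmf2TrajectoryEnergyError`
(`abs_sunOmf2ProposalN_energy_error_le`) SPECIALISED through the dictionary `SUNEnginePairing` (`B = sunCoordPairing N`
with `sunKinetic N p = 1·Σ_l B(p_l,p_l)`, `β = N + 4·#pairs`, `C_ι = 2N`) to the proposals inside the engine kernels of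
`SUNMultiStepLeapfrogHMCEngine` / `SUNMultiStepLeapfrogFTHMCEngine` (`sunLeapfrogHMCN (sunCoordι N) (sunCoordι_skew N) ε addHaar (sunKinetic N) …`)
and the `SU(N)` OMF2 proposal of `Omf2ProposalLaws` §0; nothing is cited as a fact; no number.  The action
`S : (L → SU(N)) → ℝ` is ARBITRARY (e.g. the FT action `βS_W∘F − log J`); the force field `D` is any field REPRESENTING the
differential of `a ↦ S(e_ε(a)·W)` through `sunCoordPairing N` (i.e. the `−tr`-gradient in the engine's coordinates),
bounded by `D_max` linkwise and `K`-Lipschitz in the matrix sup norm; the kicks are the consistent ones for `H = S + sunKinetic`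
(`κ = 1`): leapfrog half kick `g = −D/4`, OMF2 kicks `g₁ = −λD`, `g₂ = −(1−2λ)D`.

* **`engine_sunLeapfrogProposalN_energy_error_le`** —
  `|H(Ψ_n(q,p)) − H(q,p)| ≤ n·(N+4#pairs)K·(N²·2N)|ε|·(‖p‖ + (2n+1)D_max/4)·(Σ_l‖p_l‖ + (2n+1)|L|D_max/4 + |L|D_max/8)` for
  `Ψ_n = sunLeapfrogProposalN (sunCoordι N) (sunCoordι_skew N) ε g n`, `H = S + sunKinetic N`;
* **`engine_sunOmf2ProposalN_energy_error_le`** — the same for the OMF2 proposal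
  `flip ∘ (omf2Word g₁ (mulDrift (sunExpDrift (sunCoordι N) _ δ)) g₂)ⁿ`:
  `≤ n·(N+4#pairs)K·(N²·2N)|δ|·(‖p‖ + (n+1)γ₂)·((|1−2λ|+2|λ|+1)(Σ_l‖p_l‖ + (n+1)|L|γ₂) + 4λ²|L|D_max)`, `γ₂ = (2|λ|+|1−2λ|)D_max`.

NOT CLAIMED: that the engine's autodiff kick IS `−D/4` in these coordinates (row 9's `kickCoeffMap` dictionary; the
hypothesis `hg` is what a user checks); the mean acceptance under the engine's Gaussian refresh (needs the moments of
`e^{−sunKinetic}`, not those of `SUNMomentumLawMoments`); optimal constants; floating point; any number.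
-/

noncomputable section

namespace Summit.Ventures.LatticeQCDFlow.Exactness

open Set Function NormedSpace
open scoped Matrix Matrix.Norms.Operator

set_option backward.isDefEq.respectTransparency false

variable (N : ℕ) {L : Type*} [Fintype L]

set_option maxHeartbeats 400000 in -- RN-23 (7)(b): heavy declaration budgeted at source (lake build ≈ 10 % hungrier than the gate)
/-- **THE ENERGY ERROR OF THE ENGINE'S `n`-STEP `SU(N)` LEAPFROG PROPOSAL IN ITS OWN COORDINATES** (`sunCoordι N`,
`H = S + sunKinetic N`, consistent half kick `g = −D/4` for a `sunCoordPairing`-represented force field `D`):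
`|H(Ψ_n(q,p)) − H(q,p)| ≤ n·(N+4#pairs)K·(N²·2N)|ε|·(‖p‖ + (2n+1)D_max/4)·(Σ_l‖p_l‖ + (2n+1)|L|D_max/4 + |L|D_max/8)`. -/
theorem engine_sunLeapfrogProposalN_energy_error_le (S : (L → Matrix.specialUnitaryGroup (Fin N) ℂ) → ℝ) (ε : ℝ)
    (hd : ∀ W : L → Matrix.specialUnitaryGroup (Fin N) ℂ,
      DifferentiableAt ℝ (fun a : L → SUNCoords N => S (sunExpDrift (sunCoordι N) (sunCoordι_skew N) ε a * W)) 0)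
    (D g : (L → Matrix.specialUnitaryGroup (Fin N) ℂ) → L → SUNCoords N)
    (hD : ∀ (W : L → Matrix.specialUnitaryGroup (Fin N) ℂ) (δ : L → SUNCoords N),
      fderiv ℝ (fun a : L → SUNCoords N => S (sunExpDrift (sunCoordι N) (sunCoordι_skew N) ε a * W)) 0 δ =
        ∑ l, sunCoordPairing N (D W l) (δ l))
    {Dmax K : ℝ} (hD0 : 0 ≤ Dmax) (hK0 : 0 ≤ K)
    (hDb : ∀ (W : L → Matrix.specialUnitaryGroup (Fin N) ℂ) (l : L), ‖D W l‖ ≤ Dmax)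
    (hDK : ∀ W W' : L → Matrix.specialUnitaryGroup (Fin N) ℂ, ‖D W - D W'‖ ≤ K * ‖coeConfig W - coeConfig W'‖)
    (hg : ∀ W l, g W l = -(1 / 4 : ℝ) • D W l)
    (q : L → Matrix.specialUnitaryGroup (Fin N) ℂ) (p : L → SUNCoords N) (n : ℕ) :
    |(S (sunLeapfrogProposalN (sunCoordι N) (sunCoordι_skew N) ε g n (q, p)).1 +
        sunKinetic N (sunLeapfrogProposalN (sunCoordι N) (sunCoordι_skew N) ε g n (q, p)).2) - (S q + sunKinetic N p)| ≤
      n * ((N + 4 * Fintype.card (UpperPair N)) * K * ((Fintype.card (Fin N) : ℝ) ^ 2 * (2 * N) * |ε| *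
          (‖p‖ + (2 * n + 1) * (Dmax / 4))) *
        ((∑ l, ‖p l‖ + (2 * n + 1) * (Fintype.card L * (Dmax / 4))) + Fintype.card L * Dmax / 8)) := by
  have hg' : ∀ W l, g W l = -(1 / (4 * (1 : ℝ))) • D W l := fun W l => by rw [hg W l]; norm_num
  have hβ0 : (0 : ℝ) ≤ N + 4 * Fintype.card (UpperPair N) := by positivity
  have hC0 : (0 : ℝ) ≤ 2 * N := by positivity
  have h := abs_sunLeapfrogProposalN_energy_error_le (sunCoordι N) (sunCoordι_skew N) (sunCoordPairing N) hC0
    (norm_sunCoordι_le N) S ε 1 one_pos hd (sunCoordPairing_comm N) hβ0 (abs_sunCoordPairing_le N) D g hD hD0 hK0 hDb hDK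
    hg' q p n
  rw [sunKinetic_eq_sum_pairing, sunKinetic_eq_sum_pairing]
  simpa only [one_mul, mul_one] using h

set_option maxHeartbeats 400000 in -- RN-23 (7)(b): heavy declaration budgeted at source (lake build ≈ 10 % hungrier than the gate)
/-- **THE ENERGY ERROR OF THE ENGINE'S `n`-STEP `SU(N)` OMF2 PROPOSAL IN ITS OWN COORDINATES** (`sunCoordι N`,
`H = S + sunKinetic N`, consistent kicks `g₁ = −λD`, `g₂ = −(1−2λ)D`): with `γ₂ = (2|λ| + |1−2λ|)D_max`,
`|H(Ψ_n(q,p)) − H(q,p)| ≤ n·(N+4#pairs)K·(N²·2N)|δ|·(‖p‖ + (n+1)γ₂)·((|1−2λ|+2|λ|+1)(Σ_l‖p_l‖ + (n+1)|L|γ₂) + 4λ²|L|D_max)`. -/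
theorem engine_sunOmf2ProposalN_energy_error_le (S : (L → Matrix.specialUnitaryGroup (Fin N) ℂ) → ℝ) (δ lam : ℝ)
    (hd : ∀ W : L → Matrix.specialUnitaryGroup (Fin N) ℂ,
      DifferentiableAt ℝ (fun a : L → SUNCoords N => S (sunExpDrift (sunCoordι N) (sunCoordι_skew N) δ a * W)) 0)
    (D g₁ g₂ : (L → Matrix.specialUnitaryGroup (Fin N) ℂ) → L → SUNCoords N)
    (hD : ∀ (W : L → Matrix.specialUnitaryGroup (Fin N) ℂ) (v : L → SUNCoords N),
      fderiv ℝ (fun a : L → SUNCoords N => S (sunExpDrift (sunCoordι N) (sunCoordι_skew N) δ a * W)) 0 v =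
        ∑ l, sunCoordPairing N (D W l) (v l))
    {Dmax K : ℝ} (hD0 : 0 ≤ Dmax) (hK0 : 0 ≤ K)
    (hDb : ∀ (W : L → Matrix.specialUnitaryGroup (Fin N) ℂ) (l : L), ‖D W l‖ ≤ Dmax)
    (hDK : ∀ W W' : L → Matrix.specialUnitaryGroup (Fin N) ℂ, ‖D W - D W'‖ ≤ K * ‖coeConfig W - coeConfig W'‖)
    (hg₁ : ∀ W l, g₁ W l = -lam • D W l) (hg₂ : ∀ W l, g₂ W l = -(1 - 2 * lam) • D W l)
    (q : L → Matrix.specialUnitaryGroup (Fin N) ℂ) (p : L → SUNCoords N) (n : ℕ) :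
    |(S (((flip : Equiv.Perm ((L → Matrix.specialUnitaryGroup (Fin N) ℂ) × (L → SUNCoords N))) *
          omf2Word g₁ (mulDrift (sunExpDrift (sunCoordι N) (sunCoordι_skew N) δ)) g₂ ^ n) (q, p)).1 +
        sunKinetic N (((flip : Equiv.Perm ((L → Matrix.specialUnitaryGroup (Fin N) ℂ) × (L → SUNCoords N))) *
          omf2Word g₁ (mulDrift (sunExpDrift (sunCoordι N) (sunCoordι_skew N) δ)) g₂ ^ n) (q, p)).2) -
      (S q + sunKinetic N p)| ≤
      n * ((N + 4 * Fintype.card (UpperPair N)) * K * ((Fintype.card (Fin N) : ℝ) ^ 2 * (2 * N)) * |δ| *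
          (‖p‖ + (n + 1) * ((2 * |lam| + |1 - 2 * lam|) * Dmax)) *
        ((|1 - 2 * lam| + 2 * |lam| + 1) * (∑ l, ‖p l‖ + (n + 1) * (Fintype.card L * ((2 * |lam| + |1 - 2 * lam|) * Dmax))) +
          4 * lam ^ 2 * (Fintype.card L * Dmax))) := by
  have hg₁' : ∀ W l, g₁ W l = -(lam / (1 : ℝ)) • D W l := fun W l => by rw [hg₁ W l, div_one]
  have hg₂' : ∀ W l, g₂ W l = -((1 - 2 * lam) / (1 : ℝ)) • D W l := fun W l => by rw [hg₂ W l, div_one]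
  have hβ0 : (0 : ℝ) ≤ N + 4 * Fintype.card (UpperPair N) := by positivity
  have hC0 : (0 : ℝ) ≤ 2 * N := by positivity
  have h := abs_sunOmf2ProposalN_energy_error_le (sunCoordι N) (sunCoordι_skew N) (sunCoordPairing N) hC0
    (norm_sunCoordι_le N) S δ 1 lam one_pos hd (sunCoordPairing_comm N) hβ0 (abs_sunCoordPairing_le N) D g₁ g₂ hD hD0 hK0
    hDb hDK hg₁' hg₂' q p n
  rw [sunKinetic_eq_sum_pairing, sunKinetic_eq_sum_pairing]
  simpa only [one_mul, div_one] using h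

end Summit.Ventures.LatticeQCDFlow.Exactness
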